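import Summits.BirchSwinnertonDyer.BirchSwinnertonDyer.Theorems.PrintX8VSConjSpanGenAll
import HarnessLib

/-!
# The ψ-trick: an ALTERNATING 2-flat character of `Γ₀(N)` is Eisenstein — from THEOREM B (`p = 2`) alone

Crux `OrdMissingLowerBoundAtTwo` (stmt-BirchSwinnertonDyer-19577), ideator 1 gen 6, support for residual R1 of the
crux idea `odd-point-shimura-descent-two` (card #8, S3 `EisensteinOfTwoFlatAtTwo`, alternating type `ε = 1`).
Card #8 books the alternating type on THEOREM B′ = `SpanGenFour` (`ConjSpanGen N 4`, NOT in the tree).  This file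
proves, sorry-free, the abstract group-theoretic core of the observation in `SpanGenFour-census.md` §4:

**`eisenstein_of_alternating`.**  Let `N` be odd, `χ : Γ₀(N) → {±1}` a homomorphism killing finite-order and
trace-`±2` elements with `χ(γ) = (−1)ᵏ` whenever `|d(γ)| = 2ᵏ` (ALTERNATING 2-flat profile), and suppose an even
character `ψ` of `(ℤ/N)ˣ` with `ψ(2) = −1` kills the `d`-entries of the finite-order and trace-`±2` elements
(case (i′): `2 ∉ ±((ℤ/N)ˣ)²·D_E`; e.g. `N = 15`, `ψ = (·|5)`, the one alternating class `15a` of card #8's table).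
Then `χ = Ψ ∘ d` for an even character `Ψ` of `(ℤ/N)ˣ` with `Ψ(2) = −1` — `χ` IS Eisenstein.  Input: THEOREM B at
`p = 2` (`PrintX8VSConjSpanGenAll.conjSpanGen_holds`), nothing at `p = 4`.

So `SpanGenFour` is load-bearing for card #8 only in case (ii′) (no such `ψ`), where it serves to EXCLUDE the
alternating type (memo §4, residual R1′).  BSD is not advanced by this file.
-/

set_option linter.dupNamespace false

open scoped MatrixGroups

namespace Summit.BirchSwinnertonDyer.BirchSwinnertonDyer.Cruxes.OrdMissingLowerBoundAtTwo.PsiTrick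

open CongruenceSubgroup
open Literature.NumberTheory.EllipticCurves.Rank1Residual
open Summit.BirchSwinnertonDyer.BirchSwinnertonDyer.Theorems.PrintX8VSConjSpanGenAll (conjSpanGen_holds)

variable {N : ℕ}

/-- The `d`-entry of `γ ∈ Γ₀(N)` as a unit mod `N`, as a homomorphism (Mathlib's `Gamma0Map` lifted to units). -/
noncomputable def dUnitHom (N : ℕ) : Gamma0 N →* (ZMod N)ˣ := (Gamma0Map N).toHomUnits

theorem gamma0Map_eq_coe (γ : Gamma0 N) : Gamma0Map N γ = (dUnitHom N γ : ZMod N) := by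
  simp [dUnitHom]

theorem intCast_dEntry_eq_coe (γ : Gamma0 N) : ((dEntry γ : ℤ) : ZMod N) = (dUnitHom N γ : ZMod N) := by
  rw [intCast_dEntry, gamma0Map_eq_coe]

/-- A `Γ₀(N)` element with prescribed `d`-entry `d` coprime to `N` (as in `exists_isGoodAt_gamma0Map_eq_pow`). -/
theorem exists_gamma0Map_eq_natCast {d : ℕ} (hd : d.Coprime N) :
    ∃ g : Gamma0 N, Gamma0Map N g = (d : ZMod N) := by
  obtain ⟨u, w, huw⟩ := Nat.isCoprime_iff_coprime.mpr hd
  have hdet : Matrix.det !![u, -w; (N : ℤ), (d : ℤ)] = 1 := by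
    rw [Matrix.det_fin_two_of]
    linear_combination huw
  refine ⟨⟨⟨!![u, -w; (N : ℤ), (d : ℤ)], hdet⟩, ?_⟩, ?_⟩
  · rw [Gamma0_mem]
    simp
  · simp [Gamma0Map]

/-- `d mod N : Γ₀(N) → (ℤ/N)ˣ` is surjective. -/
theorem dUnitHom_surjective [NeZero N] : Function.Surjective (dUnitHom N) := by
  intro u
  obtain ⟨g, hg⟩ := exists_gamma0Map_eq_natCast (N := N) (ZMod.val_coe_unit_coprime u)
  refine ⟨g, Units.ext ?_⟩
  rw [← gamma0Map_eq_coe, hg, ZMod.natCast_zmod_val]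

/-- **The ψ-trick** (see the module docstring). -/
theorem eisenstein_of_alternating [NeZero N] (hN : ¬ 2 ∣ N)
    (χ : Gamma0 N →* Multiplicative (ZMod 2))
    (hfin : ∀ γ : Gamma0 N, IsOfFinOrder γ → χ γ = 1)
    (htr : ∀ γ : Gamma0 N, trEntry γ = 2 ∨ trEntry γ = -2 → χ γ = 1)
    (halt : ∀ (γ : Gamma0 N) (k : ℕ), (dEntry γ).natAbs = 2 ^ k →
      χ γ = Multiplicative.ofAdd ((k : ZMod 2)))
    (ψ : (ZMod N)ˣ →* Multiplicative (ZMod 2))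
    (hψ2 : ∀ u : (ZMod N)ˣ, (u : ZMod N) = 2 → ψ u = Multiplicative.ofAdd 1)
    (hψneg : ψ (-1) = 1)
    (hψfin : ∀ γ : Gamma0 N, IsOfFinOrder γ → ψ (dUnitHom N γ) = 1)
    (hψtr : ∀ γ : Gamma0 N, trEntry γ = 2 ∨ trEntry γ = -2 → ψ (dUnitHom N γ) = 1) :
    ∃ Ψ : (ZMod N)ˣ →* Multiplicative (ZMod 2),
      (∀ u : (ZMod N)ˣ, (u : ZMod N) = 2 → Ψ u = Multiplicative.ofAdd 1) ∧ Ψ (-1) = 1 ∧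
      ∀ γ : Gamma0 N, χ γ = Ψ (dUnitHom N γ) := by
  classical
  have hsq : ∀ x : Multiplicative (ZMod 2), x * x = 1 := by decide
  -- `2` is a unit mod `N`
  have hcop : Nat.Coprime 2 N := (Nat.Prime.coprime_iff_not_dvd Nat.prime_two).2 hN
  have h2u : IsUnit ((2 : ℕ) : ZMod N) := (ZMod.isUnit_iff_coprime 2 N).2 hcop
  set u2 : (ZMod N)ˣ := h2u.unit with hu2def
  have hu2 : (u2 : ZMod N) = 2 := by
    rw [hu2def, IsUnit.unit_spec]
    push_cast
    rfl
  -- ψ ∘ d on good elements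
  have hgood : ∀ (γ : Gamma0 N) (k : ℕ), (dEntry γ).natAbs = 2 ^ k →
      ψ (dUnitHom N γ) = Multiplicative.ofAdd ((k : ZMod 2)) := by
    intro γ k hk
    have hpow : ψ (u2 ^ k) = Multiplicative.ofAdd ((k : ZMod 2)) := by
      rw [map_pow, hψ2 u2 hu2, ← ofAdd_nsmul, nsmul_one]
    rcases Int.natAbs_eq (dEntry γ) with h | h
    · have : dUnitHom N γ = u2 ^ k := Units.ext (by
        rw [← intCast_dEntry_eq_coe, h, hk, Units.val_pow_eq_pow_val, hu2]
        push_cast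
        rfl)
      rw [this, hpow]
    · have : dUnitHom N γ = -1 * u2 ^ k := Units.ext (by
        rw [neg_one_mul, Units.val_neg, ← intCast_dEntry_eq_coe, h, hk, Units.val_pow_eq_pow_val, hu2]
        push_cast
        rfl)
      rw [this, map_mul, hψneg, one_mul, hpow]
  -- φ := χ · (ψ ∘ d)
  set φ : Gamma0 N →* Multiplicative (ZMod 2) := χ * ψ.comp (dUnitHom N) with hφdef
  have hφ : ∀ γ, φ γ = χ γ * ψ (dUnitHom N γ) := fun γ => rfl
  -- φ kills `Γ_H(N)`, `H = ⟨±2⟩`: THEOREM B at `p = 2`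
  have hker : ∀ γ : Gamma0 N, InGammaH N 2 γ → φ γ = 1 := by
    intro γ hγ
    have hmem := conjSpanGen_holds Nat.prime_two hN γ hγ
    have hle : Subgroup.closure (spanGenerators N 2) ⊔ commutator (Gamma0 N) ≤ φ.ker := by
      refine sup_le ?_ (Abelianization.commutator_subset_ker φ)
      rw [Subgroup.closure_le]
      intro g hg
      simp only [SetLike.mem_coe, MonoidHom.mem_ker, hφ]
      rcases hg with ⟨m, hm⟩ | hfo | htr2 | htr2
      · rw [halt g m hm, hgood g m hm, hsq]
      · rw [hfin g hfo, hψfin g hfo, one_mul]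
      · rw [htr g (Or.inl htr2), hψtr g (Or.inl htr2), one_mul]
      · rw [htr g (Or.inr htr2), hψtr g (Or.inr htr2), one_mul]
    exact (MonoidHom.mem_ker).1 (hle hmem)
  -- φ depends only on `d mod N`
  have hdep : ∀ γ γ' : Gamma0 N, dUnitHom N γ = dUnitHom N γ' → φ γ = φ γ' := by
    intro γ γ' h
    have h1 : InGammaH N 2 (γ * γ'⁻¹) := ⟨0, Or.inl (by
      rw [intCast_dEntry_eq_coe, map_mul, map_inv, h, mul_inv_cancel, Units.val_one, pow_zero])⟩
    have := hker _ h1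
    rwa [map_mul, map_inv, mul_inv_eq_one] at this
  -- a section of `d mod N`
  have hsurj := dUnitHom_surjective (N := N)
  set s : (ZMod N)ˣ → Gamma0 N := Function.surjInv hsurj with hsdef
  have hs : ∀ u, dUnitHom N (s u) = u := fun u => Function.surjInv_eq hsurj u
  let Ψ' : (ZMod N)ˣ →* Multiplicative (ZMod 2) :=
    { toFun := fun u => φ (s u)
      map_one' := by
        have := hdep (s 1) 1 (by rw [hs, map_one])
        rw [this, map_one]
      map_mul' := by
        intro u v
        have := hdep (s (u * v)) (s u * s v) (by rw [map_mul, hs, hs, hs])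
        rw [this, map_mul] }
  have hΨ' : ∀ u, Ψ' u = φ (s u) := fun u => rfl
  refine ⟨Ψ' * ψ, ?_, ?_, ?_⟩
  · intro u hu
    have h1 : InGammaH N 2 (s u) := ⟨1, Or.inl (by
      rw [intCast_dEntry_eq_coe, hs, hu, pow_one]
      push_cast
      rfl)⟩
    rw [MonoidHom.mul_apply, hΨ', hker _ h1, one_mul, hψ2 u hu]
  · have h1 : InGammaH N 2 (s (-1)) := ⟨0, Or.inr (by
      rw [intCast_dEntry_eq_coe, hs, Units.val_neg, Units.val_one, pow_zero])⟩
    rw [MonoidHom.mul_apply, hΨ', hker _ h1, hψneg, one_mul]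
  · intro γ
    rw [MonoidHom.mul_apply, hΨ', ← hdep γ (s (dUnitHom N γ)) (by rw [hs]), hφ, mul_assoc, hsq, mul_one]

/-- **Case (ii′) needs B′.**  GIVEN `ConjSpanGen N 4` (THEOREM B′ at level `N`, open in general; certified by exact
homology for every odd `N ≤ 199`, kit j310479), an alternating 2-flat character `χ` is Eisenstein with an even
character `Ψ`, `Ψ(2) = −1` — no auxiliary `ψ` needed. -/
theorem eisenstein_of_alternating_of_conjSpanGenFour [NeZero N] (hN : ¬ 2 ∣ N) (hB : ConjSpanGen N 4)
    (χ : Gamma0 N →* Multiplicative (ZMod 2))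
    (hfin : ∀ γ : Gamma0 N, IsOfFinOrder γ → χ γ = 1)
    (htr : ∀ γ : Gamma0 N, trEntry γ = 2 ∨ trEntry γ = -2 → χ γ = 1)
    (halt : ∀ (γ : Gamma0 N) (k : ℕ), (dEntry γ).natAbs = 2 ^ k →
      χ γ = Multiplicative.ofAdd ((k : ZMod 2))) :
    ∃ Ψ : (ZMod N)ˣ →* Multiplicative (ZMod 2),
      (∀ u : (ZMod N)ˣ, (u : ZMod N) = 2 → Ψ u = Multiplicative.ofAdd 1) ∧ Ψ (-1) = 1 ∧
      ∀ γ : Gamma0 N, χ γ = Ψ (dUnitHom N γ) := by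
  classical
  -- χ kills `Γ_{H₄}(N)`: good₄ elements have `|d| = 4ᵐ = 2^{2m}`, so `χ = (−1)^{2m} = 1`
  have hker : ∀ γ : Gamma0 N, InGammaH N 4 γ → χ γ = 1 := by
    intro γ hγ
    have hmem := hB γ hγ
    have hle : Subgroup.closure (spanGenerators N 4) ⊔ commutator (Gamma0 N) ≤ χ.ker := by
      refine sup_le ?_ (Abelianization.commutator_subset_ker χ)
      rw [Subgroup.closure_le]
      intro g hg
      simp only [SetLike.mem_coe, MonoidHom.mem_ker]
      rcases hg with ⟨m, hm⟩ | hfo | htr2 | htr2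
      · have h2m : (dEntry g).natAbs = 2 ^ (2 * m) := by rw [hm, pow_mul]; norm_num
        rw [halt g (2 * m) h2m]
        have : ((2 * m : ℕ) : ZMod 2) = 0 := by
          push_cast
          rw [show (2 : ZMod 2) = 0 from rfl, zero_mul]
        rw [this]
        rfl
      · exact hfin g hfo
      · exact htr g (Or.inl htr2)
      · exact htr g (Or.inr htr2)
    exact (MonoidHom.mem_ker).1 (hle hmem)
  have hdep : ∀ γ γ' : Gamma0 N, dUnitHom N γ = dUnitHom N γ' → χ γ = χ γ' := by
    intro γ γ' h
    have h1 : InGammaH N 4 (γ * γ'⁻¹) := ⟨0, Or.inl (by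
      rw [intCast_dEntry_eq_coe, map_mul, map_inv, h, mul_inv_cancel, Units.val_one, pow_zero])⟩
    have := hker _ h1
    rwa [map_mul, map_inv, mul_inv_eq_one] at this
  have hsurj := dUnitHom_surjective (N := N)
  set s : (ZMod N)ˣ → Gamma0 N := Function.surjInv hsurj with hsdef
  have hs : ∀ u, dUnitHom N (s u) = u := fun u => Function.surjInv_eq hsurj u
  let Ψ : (ZMod N)ˣ →* Multiplicative (ZMod 2) :=
    { toFun := fun u => χ (s u)
      map_one' := by
        have := hdep (s 1) 1 (by rw [hs, map_one])
        rw [this, map_one]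
      map_mul' := by
        intro u v
        have := hdep (s (u * v)) (s u * s v) (by rw [map_mul, hs, hs, hs])
        rw [this, map_mul] }
  have hΨ : ∀ u, Ψ u = χ (s u) := fun u => rfl
  refine ⟨Ψ, ?_, ?_, ?_⟩
  · intro u hu
    -- compare `s u` with the GOOD element `(x, −w; N, 2)` of `d`-entry exactly `2`
    have hcop : Nat.Coprime 2 N := (Nat.Prime.coprime_iff_not_dvd Nat.prime_two).2 hN
    obtain ⟨x, w, hxw⟩ := Nat.isCoprime_iff_coprime.mpr hcop
    have hdet : Matrix.det !![x, -w; (N : ℤ), (2 : ℤ)] = 1 := by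
      rw [Matrix.det_fin_two_of]
      linear_combination hxw
    set g : Gamma0 N := ⟨⟨!![x, -w; (N : ℤ), (2 : ℤ)], hdet⟩, by rw [Gamma0_mem]; simp⟩ with hgdef
    have hd2 : dEntry g = 2 := by simp [dEntry, hgdef]
    have hdg : dUnitHom N g = u := Units.ext (by
      rw [← intCast_dEntry_eq_coe, hd2, hu]
      push_cast
      rfl)
    have hχg : χ g = Multiplicative.ofAdd 1 := by
      have := halt g 1 (by rw [hd2]; rfl)
      rw [this]
      push_cast
      rfl
    rw [hΨ, hdep (s u) g (by rw [hs, hdg]), hχg]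
  · have h1 : InGammaH N 4 (s (-1)) := ⟨0, Or.inr (by
      rw [intCast_dEntry_eq_coe, hs, Units.val_neg, Units.val_one, pow_zero])⟩
    rw [hΨ, hker _ h1]
  · intro γ
    rw [hΨ, ← hdep γ (s (dUnitHom N γ)) (by rw [hs])]

end Summit.BirchSwinnertonDyer.BirchSwinnertonDyer.Cruxes.OrdMissingLowerBoundAtTwo.PsiTrick
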